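import Summits.CriticalPhenomena.CardyFormulaZ2.Theorems.CardyMagicRigidityPinchResamplingDefsV4
import Summits.CriticalPhenomena.CardyFormulaZ2.Theorems.CardyMagicRigidityNestingRigidityBlindCouplings
import Summits.CriticalPhenomena.CardyFormulaZ2.Theorems.CardyMagicRigidityNestingRigidityCouplingPlumbing
import Summits.CriticalPhenomena.CardyFormulaZ2.Theorems.CardyMagicRigidityNestingRigidityRecoupling
import Summits.CriticalPhenomena.CardyFormulaZ2.Theorems.CardyMagicRigidityNestingRigidityBigLoopsReduction
import Summits.CriticalPhenomena.CardyFormulaZ2.Theorems.CardyMagicRigidityNestingRigidityGoodEventCounting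
import Summits.CriticalPhenomena.CardyFormulaZ2.Theorems.CardyMagicRigidityNestingRigiditySixArmZ2OfFiveArm
import Literature.Probability.Percolation.LoopRepresentationProofs
import HarnessLib

/-!
# Assembly shell of the neck-tomography transfer (stub S10' `stub_neckTomographyV4`, bricks B9/B10)

Crux `Summit.CriticalPhenomena.CardyFormulaZ2.Theses.CardyMagicRigidity.NestingRigidity`
(stmt-CriticalPhenomena-4835), line `pinch-resampling` v4, registered stub
`stub_neckTomographyV4 : FiveArmUpperT → FiveArmUpperZ2 → NoNeckRigidity → NeckHookupCoarseT → NeckHookupCoarseZ2 →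
LoopLimitZ2Blind → LoopLimitZ2EqT` (vocabulary `…PinchResamplingDefs{,V3,V4}`).  This file is the sorry-free OUTER
SHELL of the transfer (typing note `S10p-typing.md`, assembly list A1/A10–A12): it pins the stub, by name and signature,
to the production — for every target precision `η`, some blind precision `ε` and all small meshes `δ` — of a
RE-COUPLING of an arbitrary blind-good coupling under which the MACROSCOPIC loops (diameter `≥ η/8`, trace in the
window `B(0, 1/η)`) are `udist`-matched off an event of probability `< η/2`.  Everything below that (regions, blob
graph, identification, positivity, arc matching) produces the fibre data consumed here.

* §1 `loopLimitZ2EqT_of_blind_of_bigLoops_recoupling` (registered anchor, B10): `LoopLimitZ2Blind → LoopLimitZ2EqT`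
  from the re-coupling statement.  Proof: blind universality supplies blind-good couplings for all small `δ`
  (`couplings_of_loopLimitZ2Blind`, B1b p144747); the hypothesis improves them; the law-level reduction
  `cnLawEDist_le_of_bigLoops_matched` (line `markov-cascade-one-generation`, in tree) matches the SMALL loops for free
  by the density of microscopic loops of both types on both lattices, so no blind-closeness needs to survive the
  re-coupling (the audit's brick B4 is thereby bypassed: after re-drawing the region interiors the two configurations
  are no longer blind-close at precision `ε ≪ r` inside the regions, but density does not care); then
  `tendsto_nhds_zero_iff_forall_ofReal` (B1a p144483) and `loopLimitZ2EqT_iff`.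
* §2 `exists_coupling_apply_le_of_fibres` (B10'): the re-coupling itself is ALWAYS obtained by disintegration
  (`map_fst_comp_eq_and_map_snd_comp_eq_of_condDistrib`, B2 p144248) from DISCRETE retained data `Y`, `Y'` (at fixed
  mesh: the selected cells and the two configurations off the region interiors INSIDE a finite box around the window —
  loops in the window are determined there) and arbitrary fibre couplings `q (y, y')` of the two conditional laws; its
  bad-event charge is `≤ P[(Y, Y') ∉ G] + sup_{G} q(·)[bad]` (`comp_map_apply_le`).  With §1 this gives
  `loopLimitZ2EqT_of_blind_of_fibres`: **S10' reduces literally to producing, for blind-good `P`, good data `G` of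
  `P`-probability `≥ 1 − η/5` and fibre couplings charging the big-loop mismatch by `≤ η/5` on `G`** — the content of
  D1 (blob-graph structure), identification (S11/S12), positivity, S9 + loop gluing.
* §3 `sixArm_boxes_le_of_ratio_le` (B9): the good event G1/G2 on `𝕋` in the form the assembly uses — under
  `FiveArmUpperT`, for every box-count constant `K` and tolerance `t > 0` there is a scale ratio `c > 0` such that
  `#S ≤ K (n/m)²` and `m ≤ c · n` force `P_{1/2}(six alternating arms `m → n` around some centre of `S`) ≤ t`
  (`sixArm_boxes_le_of_fiveArmUpperT`, B7 p151342, and the choice `K C c^α ≤ t`).  With `m = r/δ`, `n = θ/δ`, `S` the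
  `r`-grid of the window this is "`P(G1 fails) ≤ η/10` once `r ≤ c(η) θ`", uniformly in `δ`.
* §4 `sixArmZ2_boxes_le_of_ratio_le` (B9, `ℤ²` twin): the same under `FiveArmUpperZ2` for the cluster-form six-arm event
  `sixArmThreeClustersAt c m n` (three open crossings of `c + A_{m,n}` in pairwise distinct open clusters of the annulus — the event
  produced by three interface strands crossing the annulus), from `sixArmZ2_le_of_fiveArmUpperZ2'` (p151354, Reimer on `ℤ²`) and the
  lattice-free counting shell `measureReal_biUnion_le_of_card_le` (B7); the events are already centred, so no translation step.
-/

noncomputable section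

namespace Summit.CriticalPhenomena.CardyFormulaZ2.Cruxes.NestingRigidity.PinchResampling

open Summit.CriticalPhenomena.CardyFormulaZ2.Theses.CardyMagicRigidity
open Summit.CriticalPhenomena.CardyFormulaZ2.Cruxes.NestingRigidity.MarkovCascadeOneGeneration
open MeasureTheory ProbabilityTheory Filter Set Literature.Probability.Percolation Literature.Probability.LatticeModels
  Literature.Probability.RandomPlanarGeometry
open scoped ENNReal Topology

/-! ## §1 The outer shell: blind universality + big-loop re-coupling ⟹ the target -/

/-- **B10 (registered anchor): the transfer reduces to re-coupling the macroscopic loops.**  Suppose that for every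
target precision `η > 0` there is a blind precision `ε > 0` such that for all small meshes `δ > 0`, EVERY coupling `P`
of critical bond percolation on `ℤ²` and critical site percolation on `𝕋` with
`P[¬ IsBlindClose ε (bondLoopConfig δ 0) (siteLoopConfig δ)] < ε` can be replaced by a coupling `Q` (same marginals)
under which the big loops — diameter `≥ η/8`, trace in `B(0, 1/η)`, either lattice, either type — all have a same-type
partner at `udist ≤ η`, off an event of `Q`-probability `< η/2`.  Then `LoopLimitZ2Blind → LoopLimitZ2EqT`.
(Small loops are matched by density inside `cnLawEDist_le_of_bigLoops_matched`; blind couplings exist eventually by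
`couplings_of_loopLimitZ2Blind`.) -/
theorem loopLimitZ2EqT_of_blind_of_bigLoops_recoupling : (∀ η : ℝ, 0 < η → ∃ ε : ℝ, 0 < ε ∧ ∀ᶠ δ in nhdsWithin (0 : ℝ) (Set.Ioi 0), ∀ P : MeasureTheory.Measure (Literature.Probability.Percolation.BondConfig (Literature.Probability.LatticeModels.Site 2) × Literature.Probability.Percolation.SiteConfig (Literature.Probability.LatticeModels.Site 2)), P.map Prod.fst = Literature.Probability.Percolation.bondPercolation (Literature.Probability.LatticeModels.zdGraph 2) Literature.Probability.Percolation.half → P.map Prod.snd = Literature.Probability.LatticeModels.triSitePercolation Literature.Probability.Percolation.half → P {p | ¬ Literature.Probability.RandomPlanarGeometry.LoopConfig.IsBlindClose ε (Literature.Probability.Percolation.bondLoopConfig δ 0 p.1) (Literature.Probability.Percolation.siteLoopConfig δ p.2)} < ENNReal.ofReal ε → ∃ Q : MeasureTheory.Measure (Literature.Probability.Percolation.BondConfig (Literature.Probability.LatticeModels.Site 2) × Literature.Probability.Percolation.SiteConfig (Literature.Probability.LatticeModels.Site 2)), Q.map Prod.fst = Literature.Probability.Percolation.bondPercolation (Literature.Probability.LatticeModels.zdGraph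 2) Literature.Probability.Percolation.half ∧ Q.map Prod.snd = Literature.Probability.LatticeModels.triSitePercolation Literature.Probability.Percolation.half ∧ Q {p | ∃ i : Fin 2, (∃ u ∈ (Literature.Probability.Percolation.bondLoopConfig δ 0 p.1).F i, u.range ⊆ Metric.ball (0 : ℂ) (1 / η) ∧ η / 8 ≤ Metric.diam u.range ∧ ∀ u' ∈ (Literature.Probability.Percolation.siteLoopConfig δ p.2).F i, η < u.udist u') ∨ (∃ u' ∈ (Literature.Probability.Percolation.siteLoopConfig δ p.2).F i, u'.range ⊆ Metric.ball (0 : ℂ) (1 / η) ∧ η / 8 ≤ Metric.diam u'.range ∧ ∀ u ∈ (Literature.Probability.Percolation.bondLoopConfig δ 0 p.1).F i, η < u'.udist u)} < ENNReal.ofReal (η / 2)) → LoopLimitZ2Blind → LoopLimitZ2EqT := by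
  intro h hB
  rw [loopLimitZ2EqT_iff]
  refine tendsto_nhds_zero_iff_forall_ofReal.2 fun η hη ↦ ?_
  obtain ⟨ε, hε, hev⟩ := h η hη
  filter_upwards [hev, couplings_of_loopLimitZ2Blind hB ε hε, cnLawEDist_le_of_bigLoops_matched hη]
    with δ h₁ h₂ h₃
  obtain ⟨P, hP₁, hP₂, hP⟩ := h₂
  obtain ⟨Q, hQ₁, hQ₂, hQ⟩ := h₁ P hP₁ hP₂ hP
  exact h₃ Q hQ₁ hQ₂ hQ

/-! ## §2 The re-coupling is a disintegration over discrete retained data -/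

section Fibres

variable {S S' : Type*} [MeasurableSpace S] [MeasurableSpace S'] [Countable S] [Countable S']
  [MeasurableSingletonClass S] [MeasurableSingletonClass S']


/-- A fibre measure whose first marginal is a conditional law is a probability measure; in particular it charges
every set by at most `1`. -/
theorem apply_le_one_of_map_fst_eq_condDistrib {Ω Ω' T : Type*} [MeasurableSpace Ω] [StandardBorelSpace Ω]
    [Nonempty Ω] [MeasurableSpace Ω'] [MeasurableSpace T] {μ : Measure Ω} [IsFiniteMeasure μ] {Y : Ω → T}
    {ρ : Measure (Ω × Ω')} {y : T} (h : ρ.map Prod.fst = condDistrib id Y μ y) (B : Set (Ω × Ω')) : ρ B ≤ 1 := by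
  have huniv : ρ univ = 1 := by
    have h' := congrArg (fun ν : Measure Ω ↦ ν univ) h
    simp only [Measure.map_apply measurable_fst MeasurableSet.univ, preimage_univ, measure_univ] at h'
    exact h'
  exact (measure_mono (subset_univ B)).trans huniv.le

/-! The conditional laws `ProbabilityTheory.condDistrib` need the configuration spaces to be standard Borel; they are
(`standardBorelSpace_bondConfig`, `standardBorelSpace_siteConfig`, countable products of `Prop`), and the statements
below take the instances as arguments (supply them with `haveI := standardBorelSpace_bondConfig` etc.; `Prop`-valued
class, so any two instances agree). -/

variable [StandardBorelSpace (BondConfig (Site 2))] [StandardBorelSpace (SiteConfig (Site 2))]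

/-- **B10': re-coupling from fibre couplings over discrete data.**  Let `P` couple `P_{ℤ²}` and `P_𝕋`, let
`Y`, `Y'` be measurable statistics with COUNTABLE DISCRETE values (at fixed mesh: selected cells and the exterior
configurations inside a finite box), and let `q (y, y')` be, for every data pair, a coupling of the conditional law of
the `ℤ²`-configuration given `Y = y` with the conditional law of the `𝕋`-configuration given `Y' = y'`
(`ProbabilityTheory.condDistrib id`).  If the data pair lies outside a set `G` with `P`-probability `≤ a`, and on `G`
the fibre couplings charge a measurable bad event `B` by `≤ b`, then gluing (`q ∘ₘ Law_P(Y, Y')`,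
`map_fst_comp_eq_and_map_snd_comp_eq_of_condDistrib`: kernels over countable discrete data are automatic) yields a
coupling `Q` of `P_{ℤ²}` and `P_𝕋` with `Q B ≤ a + b`.  In the transfer `G` = (good events on both sides, blind-close,
data correspond) and `b` = the total-variation mismatch of the two routing laws plus the failure probability of the
arc matching. -/
theorem exists_coupling_apply_le_of_fibres
    (P : Measure (BondConfig (Site 2) × SiteConfig (Site 2)))
    (hP₁ : P.map Prod.fst = bondPercolation (zdGraph 2) half) (hP₂ : P.map Prod.snd = triSitePercolation half)
    {Y : BondConfig (Site 2) → S} {Y' : SiteConfig (Site 2) → S'} (hY : Measurable Y) (hY' : Measurable Y')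
    (q : S × S' → Measure (BondConfig (Site 2) × SiteConfig (Site 2)))
    (hq₁ : ∀ p, (q p).map Prod.fst = condDistrib id Y (bondPercolation (zdGraph 2) half) p.1)
    (hq₂ : ∀ p, (q p).map Prod.snd = condDistrib id Y' (triSitePercolation half) p.2)
    {B : Set (BondConfig (Site 2) × SiteConfig (Site 2))} (hB : MeasurableSet B) {G : Set (S × S')} {a b : ℝ≥0∞}
    (hG : P {p | (Y p.1, Y' p.2) ∉ G} ≤ a) (hfib : ∀ p ∈ G, q p B ≤ b) :
    ∃ Q : Measure (BondConfig (Site 2) × SiteConfig (Site 2)),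
      Q.map Prod.fst = bondPercolation (zdGraph 2) half ∧ Q.map Prod.snd = triSitePercolation half ∧
        Q B ≤ a + b := by
  classical
  have hPuniv : P univ = 1 := by
    have h := congrArg (fun μ : Measure (BondConfig (Site 2)) ↦ μ univ) hP₁
    simpa only [Measure.map_apply measurable_fst MeasurableSet.univ, preimage_univ, measure_univ] using h
  haveI : IsProbabilityMeasure P := ⟨hPuniv⟩
  set κ : Kernel (S × S') (BondConfig (Site 2) × SiteConfig (Site 2)) := Kernel.ofFunOfCountable q with hκ
  have hYY' : Measurable fun p : BondConfig (Site 2) × SiteConfig (Site 2) ↦ (Y p.1, Y' p.2) :=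
    (hY.comp measurable_fst).prodMk (hY'.comp measurable_snd)
  set ν : Measure (S × S') := P.map fun p ↦ (Y p.1, Y' p.2) with hν
  haveI : IsProbabilityMeasure ν := Measure.isProbabilityMeasure_map hYY'.aemeasurable
  obtain ⟨hQ₁, hQ₂⟩ := map_fst_comp_eq_and_map_snd_comp_eq_of_condDistrib (bondPercolation (zdGraph 2) half)
    (triSitePercolation half) P Y Y' κ hP₁ hP₂ hY hY' (Eventually.of_forall fun p ↦ hq₁ p)
    (Eventually.of_forall fun p ↦ hq₂ p)
  refine ⟨κ ∘ₘ ν, hQ₁, hQ₂, ?_⟩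
  -- fibrewise bound: `b` on `G`, `1` off `G`
  set g : S × S' → ℝ≥0∞ := fun p ↦ G.indicator (fun _ ↦ b) p + Gᶜ.indicator (fun _ ↦ 1) p with hg
  have hfib' : ∀ᵐ p ∂ν, κ p B ≤ g p := by
    refine Eventually.of_forall fun p ↦ ?_
    by_cases hp : p ∈ G
    · simp only [hg, indicator_of_mem hp, indicator_of_notMem (notMem_compl_iff.2 hp), add_zero]
      exact hfib p hp
    · simp only [hg, indicator_of_notMem hp, indicator_of_mem (mem_compl hp), zero_add]
      exact apply_le_one_of_map_fst_eq_condDistrib (hq₁ p) B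
  have hGm : MeasurableSet G := G.to_countable.measurableSet
  calc (κ ∘ₘ ν) B ≤ ∫⁻ p, g p ∂ν := comp_map_apply_le P Y Y' κ hB hfib'
    _ = b * ν G + ν Gᶜ := by
        rw [hg, lintegral_add_left (measurable_const.indicator hGm), lintegral_indicator_const hGm,
          lintegral_indicator_const hGm.compl, one_mul]
    _ ≤ b * 1 + a := by
        gcongr
        · exact prob_le_one
        · rw [hν, Measure.map_apply hYY' hGm.compl]
          exact hG
    _ = a + b := by rw [mul_one, add_comm]

end Fibres

/-- **S10' reduced to fibre data (composition of B10 and B10').**  If for every `η > 0` there is `ε > 0` such that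
for all small `δ`, for every blind-good coupling `P` there are countable discrete statistics `Y`, `Y'`, fibre
couplings `q` of the conditional laws, a good data set `G` missed with `P`-probability `≤ η/5`, and a MEASURABLE event
`B` containing the big-loop mismatch event and charged by `≤ η/5` by every fibre coupling over `G`, then
`LoopLimitZ2Blind → LoopLimitZ2EqT`.  (The data types may depend on `η, ε, δ, P`; `η/5 + η/5 < η/2`; the measurable
container `B` — in the transfer: "routing states differ on a selected cell, or an arc matching fails", a finite-box
event — spares any measurability discussion of loop events.) -/
theorem loopLimitZ2EqT_of_blind_of_fibres [StandardBorelSpace (BondConfig (Site 2))]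
    [StandardBorelSpace (SiteConfig (Site 2))]
    (h : ∀ η : ℝ, 0 < η → ∃ ε : ℝ, 0 < ε ∧ ∀ᶠ δ in nhdsWithin (0 : ℝ) (Set.Ioi 0),
      ∀ P : Measure (BondConfig (Site 2) × SiteConfig (Site 2)),
        P.map Prod.fst = bondPercolation (zdGraph 2) half → P.map Prod.snd = triSitePercolation half →
        P {p | ¬ LoopConfig.IsBlindClose ε (bondLoopConfig δ 0 p.1) (siteLoopConfig δ p.2)} < ENNReal.ofReal ε →
        ∃ (S S' : Type) (_ : MeasurableSpace S) (_ : MeasurableSpace S') (_ : Countable S) (_ : Countable S')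
          (_ : MeasurableSingletonClass S) (_ : MeasurableSingletonClass S')
          (Y : BondConfig (Site 2) → S) (Y' : SiteConfig (Site 2) → S')
          (q : S × S' → Measure (BondConfig (Site 2) × SiteConfig (Site 2))) (G : Set (S × S'))
          (B : Set (BondConfig (Site 2) × SiteConfig (Site 2))),
          Measurable Y ∧ Measurable Y' ∧
          (∀ p, (q p).map Prod.fst = condDistrib id Y (bondPercolation (zdGraph 2) half) p.1) ∧
          (∀ p, (q p).map Prod.snd = condDistrib id Y' (triSitePercolation half) p.2) ∧
          P {p | (Y p.1, Y' p.2) ∉ G} ≤ ENNReal.ofReal (η / 5) ∧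
          MeasurableSet B ∧ (∀ p ∈ G, q p B ≤ ENNReal.ofReal (η / 5)) ∧
          {p | ∃ i : Fin 2,
            (∃ u ∈ (bondLoopConfig δ 0 p.1).F i, u.range ⊆ Metric.ball (0 : ℂ) (1 / η) ∧
              η / 8 ≤ Metric.diam u.range ∧ ∀ u' ∈ (siteLoopConfig δ p.2).F i, η < u.udist u') ∨
            (∃ u' ∈ (siteLoopConfig δ p.2).F i, u'.range ⊆ Metric.ball (0 : ℂ) (1 / η) ∧
              η / 8 ≤ Metric.diam u'.range ∧ ∀ u ∈ (bondLoopConfig δ 0 p.1).F i, η < u'.udist u)} ⊆ B) :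
    LoopLimitZ2Blind → LoopLimitZ2EqT := by
  refine loopLimitZ2EqT_of_blind_of_bigLoops_recoupling fun η hη ↦ ?_
  obtain ⟨ε, hε, hev⟩ := h η hη
  refine ⟨ε, hε, ?_⟩
  filter_upwards [hev] with δ hδ P hP₁ hP₂ hP
  obtain ⟨S, S', _, _, _, _, _, _, Y, Y', q, G, B, hY, hY', hq₁, hq₂, hG, hBm, hfib, hsub⟩ := hδ P hP₁ hP₂ hP
  obtain ⟨Q, hQ₁, hQ₂, hQ⟩ := exists_coupling_apply_le_of_fibres P hP₁ hP₂ hY hY' q hq₁ hq₂ hBm hG hfib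
  refine ⟨Q, hQ₁, hQ₂, ((measure_mono hsub).trans hQ).trans_lt ?_⟩
  rw [← ENNReal.ofReal_add (by positivity) (by positivity)]
  exact ENNReal.ofReal_lt_ofReal_iff'.2 ⟨by linarith, by positivity⟩

/-! ## §3 B9: the good event G1/G2 on `𝕋` at a prescribed tolerance -/

/-- **B9: six-arm boxes are rare once the scale ratio is small (G1/G2 on `𝕋` in assembly form).**  Under
`FiveArmUpperT`, for every box-count constant `K ≥ 0` and tolerance `t > 0` there are `m₀` and a ratio `c > 0` such
that for all `m₀ ≤ m ≤ n` with `m ≤ c · n` and every finite set `S` of centres with `|S| ≤ K (n/m)²`, the probability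
that the order-free six-arm event `armEvent (T,F,T,F,F,T) m n` occurs around some centre of `S` is `≤ t`.  (From
`sixArm_boxes_le_of_fiveArmUpperT`: the bound `K C (m/n)^α` with `α > 0`; choose `c ≤ 1` with `K C c^α ≤ t`.)  With
`m = r/δ`, `n = θ/δ` and `S` the `r`-grid of the window `B(0, 1/η + 1)` (`|S| ≤ K(η, θ) (n/m)²`), this is the choice
`r ≤ c θ` making "some `r`-box is crossed by three macroscopic strands out to distance `θ`" (G1) — and, at scales
`(ε, λ)`, "some `ε`-shadow of length `λ`" (G2) — of probability `≤ t`, uniformly in the mesh. -/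
theorem sixArm_boxes_le_of_ratio_le (h5 : FiveArmUpperT) {K t : ℝ} (hK : 0 ≤ K) (ht : 0 < t) :
    ∃ m₀ : ℕ, ∃ c : ℝ, 0 < c ∧ ∀ m n : ℕ, m₀ ≤ m → m ≤ n → (m : ℝ) ≤ c * n →
      ∀ S : Finset (Site 2), (S.card : ℝ) ≤ K * ((n : ℝ) / m) ^ 2 →
        (triSitePercolation half).real
            (⋃ x ∈ S, SiteConfig.relabel (Equiv.subRight x) ⁻¹' armEvent ![true, false, true, false, false, true] m n)
          ≤ t := by
  obtain ⟨C, α, m₀, hC, hα, h⟩ := sixArm_boxes_le_of_fiveArmUpperT h5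
  -- the ratio: `c = min 1 ((t / (K C + 1)) ^ α⁻¹)`, so that `K C c ^ α ≤ K C t / (K C + 1) ≤ t`
  have hKC : 0 ≤ K * C := mul_nonneg hK hC
  have hq : 0 < t / (K * C + 1) := div_pos ht (by linarith)
  set c : ℝ := min 1 ((t / (K * C + 1)) ^ α⁻¹) with hc
  have hc0 : 0 < c := lt_min one_pos (Real.rpow_pos_of_pos hq _)
  refine ⟨max m₀ 1, c, hc0, fun m n hm hmn hratio S hS ↦ ?_⟩
  have hm1 : (1 : ℝ) ≤ m := by exact_mod_cast le_of_max_le_right hm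
  have hn0 : (0 : ℝ) < n := by
    have : (1 : ℝ) ≤ n := hm1.trans (by exact_mod_cast hmn)
    linarith
  have hx0 : 0 ≤ (m : ℝ) / n := by positivity
  have hxc : (m : ℝ) / n ≤ c := by rwa [div_le_iff₀ hn0]
  have hcα : c ^ α ≤ t / (K * C + 1) := by
    calc c ^ α ≤ ((t / (K * C + 1)) ^ α⁻¹) ^ α :=
          Real.rpow_le_rpow hc0.le (min_le_right _ _) hα.le
      _ = t / (K * C + 1) := Real.rpow_inv_rpow hq.le hα.ne'
  calc (triSitePercolation half).real
        (⋃ x ∈ S, SiteConfig.relabel (Equiv.subRight x) ⁻¹' armEvent ![true, false, true, false, false, true] m n)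
      ≤ K * C * ((m : ℝ) / n) ^ α := h K hK m n (le_of_max_le_left hm) hmn S hS
    _ ≤ K * C * c ^ α := mul_le_mul_of_nonneg_left (Real.rpow_le_rpow hx0 hxc hα.le) hKC
    _ ≤ K * C * (t / (K * C + 1)) := mul_le_mul_of_nonneg_left hcα hKC
    _ ≤ t := by
        rw [← mul_div_assoc, div_le_iff₀ (by linarith : (0 : ℝ) < K * C + 1)]
        nlinarith

/-! ## §4 B9 on `ℤ²`: six-arm boxes under `FiveArmUpperZ2` -/

/-- **B9, `ℤ²` twin: six-arm boxes are rare once the scale ratio is small.**  Under `FiveArmUpperZ2`, for every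
box-count constant `K ≥ 0` and tolerance `t > 0` there is a ratio `c₀ > 0` such that for all `1 ≤ m ≤ n` with
`m ≤ c₀ · n` and every finite set `S` of centres with `|S| ≤ K (n/m)²`, the probability that around some centre
`c ∈ S` the annulus `c + A_{m,n}` has three open crossings in pairwise distinct open clusters of the annulus
(`sixArmThreeClustersAt`, the cluster form of six alternating arms) is `≤ t`.  (Union bound
`measureReal_biUnion_le_of_card_le` with the six-arm bound `C (m/n)² (m/n)^ε` of `sixArmZ2_le_of_fiveArmUpperZ2'`,
then the choice `K C c₀^ε ≤ t`.)  This is G1/G2 on `ℤ²` at a prescribed tolerance, uniformly in the mesh. -/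
theorem sixArmZ2_boxes_le_of_ratio_le : FiveArmUpperZ2 → ∀ {K t : ℝ}, 0 ≤ K → 0 < t → ∃ c₀ : ℝ, 0 < c₀ ∧ ∀ m n : ℕ, 1 ≤ m → m ≤ n → (m : ℝ) ≤ c₀ * n → ∀ S : Finset (Site 2), (S.card : ℝ) ≤ K * ((n : ℝ) / m) ^ 2 → (bondPercolation (zdGraph 2) half).real (⋃ c ∈ S, Summit.CriticalPhenomena.CardyFormulaZ2.Theorems.CardySelfRefinement.FarField.sixArmThreeClustersAt c m n) ≤ t := by
  intro h6 K t hK ht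
  obtain ⟨C, ε, hε, h⟩ := sixArmZ2_le_of_fiveArmUpperZ2' h6
  -- a nonnegative constant
  have h' : ∀ (c : Site 2) (m n : ℕ), 1 ≤ m → m ≤ n →
      (bondPercolation (zdGraph 2) half).real
          (Summit.CriticalPhenomena.CardyFormulaZ2.Theorems.CardySelfRefinement.FarField.sixArmThreeClustersAt c m n) ≤
        max C 0 * (((m : ℝ) / n) ^ 2 * ((m : ℝ) / n) ^ ε) := by
    intro c m n hm hmn
    have hx : ((m : ℝ) / n) ^ (2 : ℝ) = ((m : ℝ) / n) ^ 2 := Real.rpow_two _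
    calc (bondPercolation (zdGraph 2) half).real
          (Summit.CriticalPhenomena.CardyFormulaZ2.Theorems.CardySelfRefinement.FarField.sixArmThreeClustersAt c m n)
        ≤ C * (((m : ℝ) / n) ^ (2 : ℝ) * ((m : ℝ) / n) ^ ε) := h c m n hm hmn
      _ ≤ max C 0 * (((m : ℝ) / n) ^ (2 : ℝ) * ((m : ℝ) / n) ^ ε) :=
          mul_le_mul_of_nonneg_right (le_max_left _ _) (by positivity)
      _ = max C 0 * (((m : ℝ) / n) ^ 2 * ((m : ℝ) / n) ^ ε) := by rw [hx]
  have hKC : 0 ≤ K * max C 0 := mul_nonneg hK (le_max_right _ _)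
  have hq : 0 < t / (K * max C 0 + 1) := div_pos ht (by linarith)
  set c₀ : ℝ := min 1 ((t / (K * max C 0 + 1)) ^ ε⁻¹) with hc₀
  have hc0 : 0 < c₀ := lt_min one_pos (Real.rpow_pos_of_pos hq _)
  refine ⟨c₀, hc0, fun m n hm hmn hratio S hS ↦ ?_⟩
  have hm0 : m ≠ 0 := Nat.one_le_iff_ne_zero.1 hm
  have hn0 : n ≠ 0 := Nat.one_le_iff_ne_zero.1 (hm.trans hmn)
  have hn : (0 : ℝ) < n := by exact_mod_cast Nat.pos_of_ne_zero hn0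
  have hx0 : 0 ≤ (m : ℝ) / n := by positivity
  have hxc : (m : ℝ) / n ≤ c₀ := by rwa [div_le_iff₀ hn]
  have hcε : c₀ ^ ε ≤ t / (K * max C 0 + 1) := by
    calc c₀ ^ ε ≤ ((t / (K * max C 0 + 1)) ^ ε⁻¹) ^ ε :=
          Real.rpow_le_rpow hc0.le (min_le_right _ _) hε.le
      _ = t / (K * max C 0 + 1) := Real.rpow_inv_rpow hq.le hε.ne'
  calc (bondPercolation (zdGraph 2) half).real
        (⋃ c ∈ S, Summit.CriticalPhenomena.CardyFormulaZ2.Theorems.CardySelfRefinement.FarField.sixArmThreeClustersAt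
          c m n)
      ≤ K * max C 0 * ((m : ℝ) / n) ^ ε :=
        measureReal_biUnion_le_of_card_le _ S _ (le_max_right _ _) hm0 hn0 hS fun c _ ↦ h' c m n hm hmn
    _ ≤ K * max C 0 * c₀ ^ ε := mul_le_mul_of_nonneg_left (Real.rpow_le_rpow hx0 hxc hε.le) hKC
    _ ≤ K * max C 0 * (t / (K * max C 0 + 1)) := mul_le_mul_of_nonneg_left hcε hKC
    _ ≤ t := by
        rw [← mul_div_assoc, div_le_iff₀ (by linarith : (0 : ℝ) < K * max C 0 + 1)]
        nlinarith

end Summit.CriticalPhenomena.CardyFormulaZ2.Cruxes.NestingRigidity.PinchResampling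

end
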